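import Summits.NavierStokesRegularity.NavierStokesRegularity.Theorems.ArgmaxNearDoors
import Summits.NavierStokesRegularity.NavierStokesRegularity.Theorems.ArgmaxNearDoorsSplit
import HarnessLib

/-!
# ArgmaxNearDoorsAnnulus — door S36-C𝔞 «ArgmaxAnnulusDoor» (the inner cut at the parabolic scale): texts of
# record (§7 of nsreg-p1 g30's `r34/Sketch36.lean` v2 sha16 f0fe6d26e287c4b8, l.596–676 VERBATIM) + the closer

Landed by ns-s29-p2 g4 on LEAD ns-s30-p1 g3's key 2026-08-28T17:28:24Z (b) (ROUND-34 08b22d05361083d7 plate map),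
`--supports stmt-NavierStokesRegularity-0056 --as helper`, `--kind definition` (new texts `annulusDepletionIntegral`,
`ArgmaxAnnulusDoor`, `CoreSplit`).  The sketch's composition `argmaxAnnulusDoor_of : CoreSplit → ArgmaxShrinkingCoherenceDoor →
ArgmaxAnnulusDoor` is kept byte-identical; the two closing lines added here are
`coreSplit_holds : CoreSplit := coreSplit` (plate «CoreSplit» PROVED by ns-sfl-p1 g5, `…ArgmaxNearDoorsSplit` p652373 — the
δ-unfolded twin of the text) and **`argmaxAnnulusDoor_holds : ArgmaxAnnulusDoor`** :=
`argmaxAnnulusDoor_of coreSplit_holds argmaxShrinkingCoherenceDoor_holds` (door C♯ closed in `…ArgmaxNearDoors`).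

HONEST FRAME: a regularity CRITERION read at ONE POINT PER TIME (Constantin–Fefferman coherence charged on the ANNULUS
between the parabolic core `θ√(ν(T−t))` and the energy scale `2r₀(T−t)^β` around the vorticity argmax, plus a core
Lipschitz bound); UNCONDITIONAL (no named-fact hypothesis); item 0056 `NoTypeII` and NS regularity are NOT proved by this.
-/

noncomputable section

open MeasureTheory Set Function Filter Metric Real InnerProductSpace
open _root_.Topology
open scoped ENNReal NNReal RealInnerProductSpace ContDiff
open Literature.Analysis Literature.Analysis.FluidPDE
open Literature.Analysis.FluidPDE.VorticityDirectionDynamics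

set_option linter.dupNamespace false

namespace Summit.NavierStokesRegularity.NavierStokesRegularity.Theorems.ArgmaxDoors

-- nested operator types (second derivatives)
set_option maxSynthPendingDepth 3

/-! ## §7 Door S36-C𝔞 «ArgmaxAnnulusDoor»: the INNER CUT at the parabolic scale (where Type-I content lives)

Under a Type-I bound the parabolic core `|y − x̄| < θ√(ν(T−t))` of the near-field integral is automatic: parabolic
smoothing gives the scale-invariant Lipschitz bound `|ω(y,t) − ω(x̄,t)| ≤ Γ|ω(x̄,t)||y − x̄|/√(ν(T−t))` there, and
`|ω(y) − ⟪ω(y),ξ(x̄)⟫ξ(x̄)| ≤ |ω(y) − ω(x̄)|`, so the core contributes `≤ 4πθΓ|ω(x̄,t)|` to the depletion integral —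
a charge `(T−t)·4πAθΓ|ω(x̄)| ≤ 4πAθΓ·M`, as small as we please by the choice of `θ`. What remains of door C♯ is
the ANNULUS `θ√(ν(T−t)) ≤ |y − x̄| < 2r₀(T−t)^β` (`β < 1/3`; non-empty for `T − t` small): a Type-I singularity must
show vorticity-direction incoherence, as seen from its own argmax, between the parabolic scale and the energy
scale. -/

/-- support (definition): the ANNULUS DEPLETION INTEGRAL `∫_{r₁ ≤ |y−x| < r₂} |ω(y) − ⟪ω(y),ξ(x)⟫ξ(x)| |x−y|⁻³ dy`. -/
def annulusDepletionIntegral (u : ℝ → (EuclideanSpace ℝ (Fin 3)) → (EuclideanSpace ℝ (Fin 3))) (t : ℝ)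
    (x : EuclideanSpace ℝ (Fin 3)) (r₁ r₂ : ℝ) : ℝ :=
  ∫ y in ball x r₂ \ ball x r₁, ‖curl (u t) y - ⟪curl (u t) y, vorticityDirection (curl (u t)) x⟫ •
      vorticityDirection (curl (u t)) x‖ * (‖x - y‖ ^ 3)⁻¹

/-- door S36-C𝔞 «ArgmaxAnnulusDoor» (regularity criterion). There is a universal `A ≥ 0` such that: `ν > 0`,
`0 ≤ t₀ < T`, `a < 1`, `0 < ε < √3/4`, `r₀ > 0`, `0 < β < 1/3`, `θ > 0`, `Γ ≥ 0`, `(u,p)` in the frame. IF at every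
`t ∈ [t₀,T)` and every vorticity ARGMAX `x̄` with `(T − t)|ω(x̄,t)| > ε`:
(G) the PARABOLIC-CORE LIPSCHITZ bound `|ω(y,t) − ω(x̄,t)| ≤ (Γ|ω(x̄,t)|/√(ν(T−t)))·|y − x̄|` for `|y − x̄| < θ√(ν(T−t))`
(automatic under a Type-I bound, by parabolic smoothing), and
(Ann) `(T − t)·(A·∫_{θ√(ν(T−t)) ≤ |y−x̄| < 2r₀(T−t)^β} |ω(y) − ⟪ω(y),ξ(x̄)⟫ξ(x̄)| |x̄−y|⁻³ dy + 4πAθΓ|ω(x̄,t)| − ν|∇ξ(x̄,t)|²_F) ≤ a`;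
THEN `u` continues past `T`. -/
def ArgmaxAnnulusDoor : Prop :=
  ∃ A : ℝ, 0 ≤ A ∧
  ∀ (ν T t₀ a ε r₀ β θ Γ : ℝ), 0 < ν → 0 ≤ t₀ → t₀ < T → a < 1 → 0 < ε → ε < Real.sqrt 3 / 4 → 0 < r₀ →
    0 < β → β < 1 / 3 → 0 < θ → 0 ≤ Γ →
    ∀ (u : ℝ → (EuclideanSpace ℝ (Fin 3)) → (EuclideanSpace ℝ (Fin 3)))
      (p : ℝ → (EuclideanSpace ℝ (Fin 3)) → ℝ),
      IsClassicalNSSolutionOn (Ico 0 T) ν 0 u p →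
      (∀ T'' < T, HasBoundedSobolevNormsOn (Icc 0 T'') u) →
      (∀ t ∈ Ico t₀ T, ∀ x, IsVorticityArgmax u t x → ε < (T - t) * ‖curl (u t) x‖ →
        (∀ y, ‖y - x‖ < θ * Real.sqrt (ν * (T - t)) →
          ‖curl (u t) y - curl (u t) x‖ ≤ Γ * ‖curl (u t) x‖ / Real.sqrt (ν * (T - t)) * ‖y - x‖) ∧
        (T - t) * (A * annulusDepletionIntegral u t x (θ * Real.sqrt (ν * (T - t))) (2 * (r₀ * (T - t) ^ β)) +
          4 * π * A * θ * Γ * ‖curl (u t) x‖ -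
          ν * frobeniusNormSq (fderiv ℝ (vorticityDirection (curl (u t))) x)) ≤ a) →
      HasSobolevExtensionPast ν u T

/-- plate «CoreSplit» (XS–S; measure theory on `B(x,r₂) ⊆ B(x,r₁) ∪ (B(x,r₂) \ B(x,r₁))` with the pieces of
`ArgmaxDoorsDepletionBounds`: under a Lipschitz bound `|ω(y) − ω(x)| ≤ Λ|y − x|` on `B(x,r₁)` the core contributes
`≤ Λ∫_{B(x,r₁)}|x−y|⁻² = 4πr₁Λ`; integrability of the integrand on balls from smoothness). -/
def CoreSplit : Prop :=
  ∀ (ν T : ℝ) (u : ℝ → (EuclideanSpace ℝ (Fin 3)) → (EuclideanSpace ℝ (Fin 3)))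
    (p : ℝ → (EuclideanSpace ℝ (Fin 3)) → ℝ),
    IsClassicalNSSolutionOn (Ico 0 T) ν 0 u p →
    (∀ T'' < T, HasBoundedSobolevNormsOn (Icc 0 T'') u) →
    ∀ t ∈ Ico 0 T, ∀ x, curl (u t) x ≠ 0 → ∀ (r₁ r₂ Λ : ℝ), 0 < r₁ → 0 < r₂ → 0 ≤ Λ →
      (∀ y, ‖y - x‖ < r₁ → ‖curl (u t) y - curl (u t) x‖ ≤ Λ * ‖y - x‖) →
      nearDepletionIntegral u t x r₂ ≤ 4 * π * r₁ * Λ + annulusDepletionIntegral u t x r₁ r₂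

/-- **Door S36-C𝔞 from door C♯**: `CoreSplit → ArgmaxShrinkingCoherenceDoor → ArgmaxAnnulusDoor` — the core
Lipschitz bound (G) with `Λ = Γ|ω(x̄)|/√(ν(T−t))` on the ball of radius `θ√(ν(T−t))` turns C♯'s near-field
hypothesis into (Ann): `4π·θ√(ν(T−t))·Λ = 4πθΓ|ω(x̄)|`. -/
theorem argmaxAnnulusDoor_of (hP : CoreSplit) (hC : ArgmaxShrinkingCoherenceDoor) : ArgmaxAnnulusDoor := by
  obtain ⟨A, hA, hdoor⟩ := hC
  refine ⟨A, hA, ?_⟩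
  intro ν T t₀ a ε r₀ β θ Γ hν ht₀ ht₀T ha hε hε' hr₀ hβ hβ' hθ hΓ u p hsol hreg hyp
  refine hdoor ν T t₀ a ε r₀ β hν ht₀ ht₀T ha hε hε' hr₀ hβ hβ' u p hsol hreg fun t ht x hx hεx => ?_
  obtain ⟨hG, hAnn⟩ := hyp t ht x hx hεx
  have hTt : 0 < T - t := sub_pos.2 ht.2
  have hq : 0 < Real.sqrt (ν * (T - t)) := Real.sqrt_pos.2 (mul_pos hν hTt)
  have hωpos : 0 < ‖curl (u t) x‖ := by
    by_contra h
    have h0 : ‖curl (u t) x‖ = 0 := le_antisymm (not_lt.1 h) (norm_nonneg _)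
    rw [h0, mul_zero] at hεx
    exact (lt_irrefl _) (hεx.trans hε)
  have hne : curl (u t) x ≠ 0 := norm_pos_iff.1 hωpos
  have hΛ : 0 ≤ Γ * ‖curl (u t) x‖ / Real.sqrt (ν * (T - t)) := div_nonneg (mul_nonneg hΓ hωpos.le) hq.le
  have hsplit := hP ν T u p hsol hreg t ⟨ht₀.trans ht.1, ht.2⟩ x hne (θ * Real.sqrt (ν * (T - t)))
    (2 * (r₀ * (T - t) ^ β)) _ (mul_pos hθ hq) (by positivity) hΛ hG
  have hcore : 4 * π * (θ * Real.sqrt (ν * (T - t))) * (Γ * ‖curl (u t) x‖ / Real.sqrt (ν * (T - t))) =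
      4 * π * θ * Γ * ‖curl (u t) x‖ := by
    field_simp
  rw [hcore] at hsplit
  have h1 : A * nearDepletionIntegral u t x (2 * (r₀ * (T - t) ^ β)) ≤
      A * (4 * π * θ * Γ * ‖curl (u t) x‖ +
        annulusDepletionIntegral u t x (θ * Real.sqrt (ν * (T - t))) (2 * (r₀ * (T - t) ^ β))) :=
    mul_le_mul_of_nonneg_left hsplit hA
  nlinarith

/-! ### The closers -/

/-- plate «CoreSplit» DISCHARGED BY NAME: ns-sfl-p1 g5's `coreSplit` (`…ArgmaxNearDoorsSplit`, p652373) is the text with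
`nearDepletionIntegral` / `annulusDepletionIntegral` δ-unfolded. [folklore] -/
theorem coreSplit_holds : CoreSplit := coreSplit

/-- **Door S36-C𝔞 «ArgmaxAnnulusDoor» CLOSED BY NAME**: the sketch's composition `argmaxAnnulusDoor_of` applied to
«CoreSplit» (`coreSplit_holds`) and door C♯ `argmaxShrinkingCoherenceDoor_holds` (`…ArgmaxNearDoors`).  UNCONDITIONAL;
0056 `NoTypeII` / NS regularity NOT proved. [folklore] -/
theorem argmaxAnnulusDoor_holds : ArgmaxAnnulusDoor :=
  argmaxAnnulusDoor_of coreSplit_holds argmaxShrinkingCoherenceDoor_holds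

end Summit.NavierStokesRegularity.NavierStokesRegularity.Theorems.ArgmaxDoors

end
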